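import Summits.AnomalousDissipation.AnomalousDissipation.Theses.TwoAndHalfD
import Summits.AnomalousDissipation.AnomalousDissipation.Theorems.TwoAndHalfDScalarAnomalySteadySourceFormalColdStartVarianceToolkit
import Summits.AnomalousDissipation.AnomalousDissipation.Theorems.TwoAndHalfDScalarAnomalySteadySourceFormalColdStartVariance
import Summits.AnomalousDissipation.AnomalousDissipation.Theorems.TwoAndHalfDScalarAnomalySteadySourceFormalDuhamelMajorantToolkit
import Literature.Analysis.FluidPDE.PassiveScalarWellPosednessProofs
import Literature.Analysis.FluidPDE.PassiveScalarClassicalEnergy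

/-!
# S5 `stub_duhamelMajorant`: Duhamel's principle in `L²`-majorant form over a smooth drift

Stub S5 of the line `budgeted-mixer-template` (reshape r1) for the crux
`Summit.AnomalousDissipation.AnomalousDissipation.Theses.TwoAndHalfD.ScalarAnomalySteadySourceFormal`
(stmt-AnomalousDissipation-0448); the statement is registered verbatim in the line's checked
skeleton (`Cruxes/ScalarAnomalySteadySourceFormal/Lines/budgeted-mixer-template.lean`), where it
feeds the cold-start variance bound `coldStart_variance_le` (S2') and the Green–Kubo tail
`coldStart_power_ge` (S3') of the kernel-checked composition `ScalarAnomalySteadySourceFormal_of`.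

CONTENT. Let `κ > 0`, `W` a jointly smooth divergence-free drift on `T² × [0, ∞)`, `h` a smooth
profile and `ρm ≥ 0` antitone such that (Decay) every classical release `φ` of `h`
(`∂ₜφ + W·∇φ = κΔφ` on `[s, T']`, `s ≥ 0`, `φ(s) = h`) obeys `‖φ(t)‖² ≤ ρm(t - s)²‖h‖²`. If
`θ'` solves the `h`-sourced equation on `[a, b]` (`0 ≤ a < b`) from the zero datum and `ψ` is
the release of `θ'(b)` on `[b, T']`, then `‖ψ(t)‖_{L²} ≤ ‖h‖_{L²} ∫_a^b ρm(t - r) dr` for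
`t ∈ [b, T']`.

PROOF (no two-parameter propagator regularity is used — only existence of releases per datum,
linearity and the `L²`-contraction of releases):
* `release_le_of_near_profile` — ONE WINDOW: if `Φ` is a release on `[r, T']`, `r ≥ 0`, whose
  datum is `δh` up to `E` in `L²`, then `‖Φ(t)‖ ≤ δρm(t - r)‖h‖ + E` (split `Φ = (Φ - δG) + δG`
  with `G` the release of `h` from `r`, `ColdStartVariance.exists_release`; `Φ - δG` is a release
  (`unforced_sub`, `unforced_const_mul`) hence `L²`-contractive (`antitoneOn_scalarL2Sq`), `G`
  decays by (Decay), Minkowski `sqrt_integral_add_sq_le`);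
* `sqrt_scalarL2Sq_release_le_partition` — `m + 1` WINDOWS by induction: peel off the first
  window `[a, a + δ]`, `δ = (b - a)/(m + 1)`: the release `Φ` of `θ'(a + δ)` from `a + δ` has datum
  `δh + O(Cδ²)` (short cold starts, toolkit `sqrt_integral_coldStart_sub_sq_le`, with
  `C = sup_{[a,b]} ‖W·∇h - κΔh‖_{L²}`), so the one-window bound and
  `δρm(t - a - δ) ≤ ∫_{a+δ}^{a+2δ} ρm(t - r) dr` (monotonicity of `r ↦ ρm(t - r)`) control
  `‖Φ(t)‖`, while `θ' - Φ` / `ψ - Φ` are a cold start on `[a + δ, b]` released on `[b, T']`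
  (`forced_sub_unforced`, `unforced_sub`), controlled by the induction hypothesis; Minkowski
  adds up to the right-endpoint Riemann-sum bound
  `‖ψ(t)‖ ≤ ‖h‖(∫_{a+δ}^b ρm(t - r) dr + δρm(t - b)) + (m + 1)Cδ²`;
* `stub_duhamelMajorant` — `∫_{a+δ}^b ≤ ∫_a^b` (`ρm ≥ 0`) and `m → ∞`.

Supports stmt-AnomalousDissipation-0448. [folklore: Duhamel's principle in majorant form]
-/

-- the summit path `AnomalousDissipation/AnomalousDissipation` duplicates a namespace component
set_option linter.dupNamespace false

noncomputable section

namespace Summit.AnomalousDissipation.AnomalousDissipation.Theorems.ScalarAnomalySteadySourceFormal.DuhamelMajorant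

open MeasureTheory Filter Topology Set
open scoped ENNReal NNReal InnerProductSpace ContDiff
open Literature.Analysis.FunctionSpaces Literature.Analysis.FluidPDE
open Summit.AnomalousDissipation.AnomalousDissipation.Theorems.ScalarAnomalySteadySourceFormal.ColdStartVariance

variable {d : Type*} [Fintype d] [DecidableEq d]

section Windows

variable {κ : ℝ} {W : ℝ → UnitAddTorus d → EuclideanSpace ℝ d} {h : UnitAddTorus d → ℝ}
  {ρm : ℝ → ℝ}

/-! ## One window: a release whose datum is close to `δh` -/

/-- **One window.** Let releases of `h` from any `s ≥ 0` obey the majorant `ρm ≥ 0` (Decay). If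
`Φ` is a classical release on `[r, T']`, `r ≥ 0`, with `‖Φ(r) - δh‖_{L²} ≤ E` (`δ ≥ 0`), then
`‖Φ(t)‖_{L²} ≤ δρm(t - r)‖h‖_{L²} + E` for `t ∈ [r, T']`: with `G` the release of `h` from `r`
(`ColdStartVariance.exists_release`), `Φ - δG` is a release (linearity) with datum `Φ(r) - δh`,
hence `‖(Φ - δG)(t)‖ ≤ E` (`L²`-contraction `antitoneOn_scalarL2Sq`), `‖δG(t)‖ ≤ δρm(t - r)‖h‖`
by (Decay), and Minkowski. [folklore] -/
theorem release_le_of_near_profile {r T' δ E : ℝ} {Φ : ℝ → UnitAddTorus d → ℝ} (hκ : 0 < κ)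
    (hW : Torus.IsSmoothSpaceTimeOn (Ici 0) W) (hdiv : ∀ t ∈ Ici (0 : ℝ), Torus.IsDivFree (W t))
    (hh : Torus.IsSmooth h) (hnn : ∀ r, 0 ≤ ρm r)
    (hdecay : ∀ (s T' : ℝ), 0 ≤ s → ∀ φ : ℝ → UnitAddTorus d → ℝ,
      Torus.IsClassicalScalarTransportOn (Icc s T') κ W φ → φ s = h →
      ∀ t ∈ Icc s T', Torus.scalarL2Sq (φ t) ≤ ρm (t - s) ^ 2 * Torus.scalarL2Sq h)
    (hr : 0 ≤ r) (hrT : r < T') (hΦ : Torus.IsClassicalScalarTransportOn (Icc r T') κ W Φ)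
    (hδ : 0 ≤ δ) (hE : √(∫ x, (Φ r x - δ * h x) ^ 2) ≤ E) {t : ℝ} (ht : t ∈ Icc r T') :
    √(Torus.scalarL2Sq (Φ t)) ≤ δ * ρm (t - r) * √(Torus.scalarL2Sq h) + E := by
  -- the release `G` of `h` from `r` on `[r, T']`
  obtain ⟨G, hG, hGr⟩ := exists_release hκ (sub_pos.2 hrT) hW hdiv hr hh
  rw [add_sub_cancel] at hG
  have hU : UniqueDiffOn ℝ (Icc r T') := uniqueDiffOn_Icc hrT
  -- `Φ - δG` is a release with datum `Φ(r) - δh`: contraction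
  have hE' := unforced_sub hU hΦ (unforced_const_mul hU hG δ)
  have hanti := hE'.antitoneOn_scalarL2Sq hκ.le (subset_refl (Icc r T'))
  have h1 : Torus.scalarL2Sq (fun x => Φ t x - δ * G t x) ≤
      Torus.scalarL2Sq (fun x => Φ r x - δ * G r x) := hanti (left_mem_Icc.2 hrT.le) ht ht.1
  rw [hGr] at h1
  have hE1 : √(∫ x, (Φ t x - δ * G t x) ^ 2) ≤ E := (Real.sqrt_le_sqrt h1).trans hE
  -- decay of `G`
  have hG3 : √(Torus.scalarL2Sq (G t)) ≤ ρm (t - r) * √(Torus.scalarL2Sq h) := by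
    calc √(Torus.scalarL2Sq (G t)) ≤ √(ρm (t - r) ^ 2 * Torus.scalarL2Sq h) :=
          Real.sqrt_le_sqrt (hdecay r T' hr G hG hGr t ht)
      _ = ρm (t - r) * √(Torus.scalarL2Sq h) := by
          rw [Real.sqrt_mul' _ (Torus.scalarL2Sq_nonneg _), Real.sqrt_sq (hnn _)]
  -- Minkowski for `Φ(t) = (Φ - δG)(t) + δG(t)`
  have hΦt : Torus.IsSmooth (Φ t) := hΦ.smooth_scalar.isSmooth_slice ht
  have hGt : Torus.IsSmooth (G t) := hG.smooth_scalar.isSmooth_slice ht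
  have hmink := sqrt_integral_add_sq_le (f := fun x => Φ t x - δ * G t x) (g := fun x => δ * G t x)
    (hΦt.continuous.sub (continuous_const.mul hGt.continuous)) (continuous_const.mul hGt.continuous)
  simp only [sub_add_cancel] at hmink
  rw [sqrt_integral_const_mul_sq, abs_of_nonneg hδ] at hmink
  calc √(Torus.scalarL2Sq (Φ t)) = √(∫ x, Φ t x ^ 2) := rfl
    _ ≤ √(∫ x, (Φ t x - δ * G t x) ^ 2) + δ * √(∫ x, G t x ^ 2) := hmink
    _ ≤ E + δ * (ρm (t - r) * √(Torus.scalarL2Sq h)) :=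
        add_le_add hE1 (mul_le_mul_of_nonneg_left hG3 hδ)
    _ = δ * ρm (t - r) * √(Torus.scalarL2Sq h) + E := by ring

/-! ## `m + 1` windows: the Riemann-sum bound -/

/-- **The partition estimate.** Under (Decay) for `ρm ≥ 0` antitone, with
`‖W(σ)·∇h - κΔh‖_{L²} ≤ C` on `[a₀, b]` and `b < T'`: for every `m`, every `a ∈ [a₀, b)`, every
classical solution `θ'` of the `h`-sourced equation on `[a, b]` from the zero datum and every
release `ψ` of `θ'(b)` on `[b, T']`,
`‖ψ(t)‖_{L²} ≤ ‖h‖_{L²}(∫_{a+δ}^b ρm(t - r) dr + δρm(t - b)) + (m + 1)Cδ²`, `δ = (b - a)/(m + 1)`,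
for `t ∈ [b, T']` (the right-endpoint Riemann sum `∑_{j=1}^{m+1} δρm(t - a - jδ)` of the
nondecreasing `r ↦ ρm(t - r)`, bounded by the integral over `[a + δ, b]` plus the last term).
Induction on `m`: peel off the window `[a, a + δ]` — the release `Φ` of `θ'(a + δ)` from `a + δ`
has datum `δh + O(Cδ²)` (`sqrt_integral_coldStart_sub_sq_le`), so
`‖Φ(t)‖ ≤ δρm(t - a - δ)‖h‖ + Cδ² ≤ ‖h‖∫_{a+δ}^{a+2δ} ρm(t - r) dr + Cδ²`
(`release_le_of_near_profile`, monotonicity), and `θ' - Φ`, `ψ - Φ` are a cold start on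
`[a + δ, b]` released on `[b, T']` (`forced_sub_unforced`, `unforced_sub`), bounded by the
induction hypothesis; Minkowski. [folklore] -/
theorem sqrt_scalarL2Sq_release_le_partition {a₀ b T' C : ℝ} (hκ : 0 < κ)
    (hW : Torus.IsSmoothSpaceTimeOn (Ici 0) W) (hdiv : ∀ t ∈ Ici (0 : ℝ), Torus.IsDivFree (W t))
    (hh : Torus.IsSmooth h) (hanti : Antitone ρm) (hnn : ∀ r, 0 ≤ ρm r)
    (hdecay : ∀ (s T' : ℝ), 0 ≤ s → ∀ φ : ℝ → UnitAddTorus d → ℝ,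
      Torus.IsClassicalScalarTransportOn (Icc s T') κ W φ → φ s = h →
      ∀ t ∈ Icc s T', Torus.scalarL2Sq (φ t) ≤ ρm (t - s) ^ 2 * Torus.scalarL2Sq h)
    (ha₀ : 0 ≤ a₀) (hbT : b < T')
    (hC : ∀ σ ∈ Icc a₀ b,
      √(∫ x, (⟪W σ x, Torus.gradient h x⟫_ℝ - κ * Torus.laplacian h x) ^ 2) ≤ C) :
    ∀ (m : ℕ) (a : ℝ) (θ' ψ : ℝ → UnitAddTorus d → ℝ), a₀ ≤ a → a < b →
      Torus.IsClassicalScalarTransportForcedOn (Icc a b) κ W (fun _ => h) θ' →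
      θ' a = (fun _ => (0 : ℝ)) →
      Torus.IsClassicalScalarTransportOn (Icc b T') κ W ψ → ψ b = θ' b →
      ∀ t ∈ Icc b T', √(Torus.scalarL2Sq (ψ t)) ≤
        √(Torus.scalarL2Sq h) * ((∫ r in (a + (b - a) / (m + 1))..b, ρm (t - r)) +
          (b - a) / (m + 1) * ρm (t - b)) + (m + 1) * C * ((b - a) / (m + 1)) ^ 2 := by
  have hH : 0 ≤ √(Torus.scalarL2Sq h) := Real.sqrt_nonneg _
  intro m
  induction m with
  | zero =>
    intro a θ' ψ ha hab hθ' hθ'0 hψ hψb t ht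
    have hb0 : 0 ≤ b := ha₀.trans (ha.trans hab.le)
    -- the whole window `[a, b]` is one short cold start
    have hC' : ∀ σ ∈ Icc a b,
        √(∫ x, (⟪W σ x, Torus.gradient h x⟫_ℝ - κ * Torus.laplacian h x) ^ 2) ≤ C :=
      fun σ hσ => hC σ ⟨ha.trans hσ.1, hσ.2⟩
    have hest := sqrt_integral_coldStart_sub_sq_le hκ.le hab hθ' hθ'0 hC'
    rw [← hψb] at hest
    have hone := release_le_of_near_profile hκ hW hdiv hh hnn hdecay hb0 hbT hψ
      (sub_nonneg.2 hab.le) hest ht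
    simp only [Nat.cast_zero, zero_add, div_one, one_mul, add_sub_cancel,
      intervalIntegral.integral_same]
    linarith
  | succ m ih =>
    intro a θ' ψ ha hab hθ' hθ'0 hψ hψb t ht
    push_cast
    -- the mesh `δ` and the first two nodes `r₁ = a + δ`, `r₁ + δ`
    set δ : ℝ := (b - a) / ((m : ℝ) + 1 + 1) with hδ_def
    have hm0 : (0 : ℝ) < (m : ℝ) + 1 + 1 := by positivity
    have hδ : 0 < δ := div_pos (sub_pos.2 hab) hm0
    have hδba : b - a = ((m : ℝ) + 1 + 1) * δ := by
      rw [hδ_def]; field_simp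
    set r₁ : ℝ := a + δ with hr₁_def
    have har : a < r₁ := lt_add_of_pos_right a hδ
    have hrb : r₁ < b := by
      have : δ < b - a := by rw [hδba]; nlinarith
      rw [hr₁_def]; linarith
    have hr0 : 0 ≤ r₁ := ha₀.trans (ha.trans har.le)
    have hra : r₁ - a = δ := by rw [hr₁_def]; ring
    have hbr : (b - r₁) / ((m : ℝ) + 1) = δ := by
      rw [div_eq_iff (by positivity), hr₁_def]
      linear_combination hδba
    -- the release `Φ` of `θ'(r₁)` from `r₁` on `[r₁, T']`
    have hθ'r : Torus.IsSmooth (θ' r₁) := hθ'.smooth_scalar.isSmooth_slice ⟨har.le, hrb.le⟩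
    obtain ⟨Φ, hΦ, hΦr⟩ := exists_release hκ (sub_pos.2 (hrb.trans hbT)) hW hdiv hr0 hθ'r
    rw [add_sub_cancel] at hΦ
    -- (i) the first window: `Φ(r₁) = θ'(r₁) = δh + O(Cδ²)`, then the one-window bound
    have hθ'₁ := forced_restrict hθ' (Icc_subset_Icc_right hrb.le) (uniqueDiffOn_Icc har)
    have hC₁ : ∀ σ ∈ Icc a r₁,
        √(∫ x, (⟪W σ x, Torus.gradient h x⟫_ℝ - κ * Torus.laplacian h x) ^ 2) ≤ C :=
      fun σ hσ => hC σ ⟨ha.trans hσ.1, hσ.2.trans hrb.le⟩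
    have hest := sqrt_integral_coldStart_sub_sq_le hκ.le har hθ'₁ hθ'0 hC₁
    rw [← hΦr, hra] at hest
    have htr : t ∈ Icc r₁ T' := ⟨hrb.le.trans ht.1, ht.2⟩
    have hΦt := release_le_of_near_profile hκ hW hdiv hh hnn hdecay hr0 (hrb.trans hbT) hΦ hδ.le
      hest htr
    -- (ii) the remaining windows: `θ' - Φ` is a cold start on `[r₁, b]`, released as `ψ - Φ`
    have hθ'₂ := forced_restrict hθ' (Icc_subset_Icc_left har.le) (uniqueDiffOn_Icc hrb)
    have hc := forced_sub_unforced (uniqueDiffOn_Icc hrb) hθ'₂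
      (hΦ.restrict_Icc hrb (Icc_subset_Icc_right hbT.le))
    have hc0 : (fun t x => θ' t x - Φ t x) r₁ = fun _ => (0 : ℝ) := by
      funext x
      simp [hΦr]
    have hD := unforced_sub (uniqueDiffOn_Icc hbT) hψ
      (hΦ.restrict_Icc hbT (Icc_subset_Icc_left hrb.le))
    have hDb : (fun t x => ψ t x - Φ t x) b = (fun t x => θ' t x - Φ t x) b := by
      funext x
      simp [hψb]
    have hih := ih r₁ _ _ (ha.trans har.le) hrb hc hc0 hD hDb t ht
    rw [hbr] at hih
    -- (iii) the Riemann-sum step: `δ ρm(t - r₁) ≤ ∫_{r₁}^{r₁ + δ} ρm(t - r) dr`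
    have hmono : Monotone fun r => ρm (t - r) := fun x y hxy => hanti (by linarith)
    have hI1 : δ * ρm (t - r₁) ≤ ∫ r in r₁..(r₁ + δ), ρm (t - r) := by
      have hle : (∫ _ in r₁..(r₁ + δ), ρm (t - r₁)) ≤ ∫ r in r₁..(r₁ + δ), ρm (t - r) :=
        intervalIntegral.integral_mono_on (le_add_of_nonneg_right hδ.le)
          intervalIntegrable_const hmono.intervalIntegrable
          fun r hr => hanti (show t - r ≤ t - r₁ by linarith [hr.1])
      rwa [intervalIntegral.integral_const, smul_eq_mul, add_sub_cancel_left] at hle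
    have hI2 : ∫ r in r₁..b, ρm (t - r) =
        (∫ r in r₁..(r₁ + δ), ρm (t - r)) + ∫ r in (r₁ + δ)..b, ρm (t - r) :=
      (intervalIntegral.integral_add_adjacent_intervals hmono.intervalIntegrable
        hmono.intervalIntegrable).symm
    have hHI := mul_le_mul_of_nonneg_left hI1 hH
    -- (iv) Minkowski for `ψ(t) = (ψ - Φ)(t) + Φ(t)`
    have hψt : Torus.IsSmooth (ψ t) := hψ.smooth_scalar.isSmooth_slice ht
    have hΦt' : Torus.IsSmooth (Φ t) := hΦ.smooth_scalar.isSmooth_slice htr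
    have hmink := sqrt_integral_add_sq_le (f := fun x => ψ t x - Φ t x) (g := Φ t)
      (hψt.continuous.sub hΦt'.continuous) hΦt'.continuous
    simp only [sub_add_cancel] at hmink
    have hsum := add_le_add hih hΦt
    rw [hI2]
    calc √(Torus.scalarL2Sq (ψ t)) = √(∫ x, ψ t x ^ 2) := rfl
      _ ≤ √(∫ x, (ψ t x - Φ t x) ^ 2) + √(∫ x, Φ t x ^ 2) := hmink
      _ ≤ _ := hsum
      _ ≤ _ := by linarith [hHI]

end Windows

/-! ## The stub: Duhamel's principle in majorant form -/

/-- **S5 `stub_duhamelMajorant` (line `budgeted-mixer-template`, crux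
`TwoAndHalfD.ScalarAnomalySteadySourceFormal`) — Duhamel with an `L²` release majorant.** Let
`κ > 0`, `W` a jointly smooth divergence-free drift on `T² × [0, ∞)`, `h` a smooth profile and
`ρm ≥ 0` antitone such that (Decay) every classical release `φ` of `h` (`∂ₜφ + W·∇φ = κΔφ` on
`[s, T']`, `s ≥ 0`, `φ(s) = h`) obeys `‖φ(t)‖² ≤ ρm(t - s)²‖h‖²` on `[s, T']`. Let `θ'` be a
classical solution of the `h`-sourced equation on `[a, b]` (`0 ≤ a < b`) from the zero datum, and
`ψ` a classical solution of the unforced equation on `[b, T']` (`b < T'`) with `ψ(b) = θ'(b)`.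
THEN `‖ψ(t)‖_{L²} ≤ ‖h‖_{L²} ∫_a^b ρm(t - r) dr` for every `t ∈ [b, T']`. Proof: the defect
`W·∇h - κΔh` of the steady profile is jointly smooth, hence bounded in `L²` by some `C` on the
compact `[a, b]` (`IsSmoothSpaceTimeOn.exists_norm_le_of_isCompact`); the partition estimate
`sqrt_scalarL2Sq_release_le_partition` gives, for every `m`,
`‖ψ(t)‖ ≤ ‖h‖(∫_a^b ρm(t - r) dr + δρm(t - b)) + C(b - a)δ` with `δ = (b - a)/(m + 1)`; let
`m → ∞`. [folklore: Duhamel's principle in majorant form] -/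
theorem stub_duhamelMajorant :
    ∀ (κ : ℝ) (W : ℝ → UnitAddTorus (Fin 2) → EuclideanSpace ℝ (Fin 2)) (h : UnitAddTorus (Fin 2) → ℝ)
      (ρm : ℝ → ℝ),
      0 < κ → Torus.IsSmoothSpaceTimeOn (Set.Ici 0) W → (∀ t ∈ Set.Ici (0 : ℝ), Torus.IsDivFree (W t)) →
      Torus.IsSmooth h → Antitone ρm → (∀ r, 0 ≤ ρm r) →
      (∀ (s T' : ℝ), 0 ≤ s → ∀ φ : ℝ → UnitAddTorus (Fin 2) → ℝ,
          Torus.IsClassicalScalarTransportOn (Set.Icc s T') κ W φ → φ s = h →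
          ∀ t ∈ Set.Icc s T', Torus.scalarL2Sq (φ t) ≤ ρm (t - s) ^ 2 * Torus.scalarL2Sq h) →
      ∀ (a b T' : ℝ) (θ' ψ : ℝ → UnitAddTorus (Fin 2) → ℝ), 0 ≤ a → a < b → b < T' →
        Torus.IsClassicalScalarTransportForcedOn (Set.Icc a b) κ W (fun _ => h) θ' →
        θ' a = (fun _ => (0 : ℝ)) →
        Torus.IsClassicalScalarTransportOn (Set.Icc b T') κ W ψ → ψ b = θ' b →
        ∀ t ∈ Set.Icc b T',
          Real.sqrt (Torus.scalarL2Sq (ψ t)) ≤ Real.sqrt (Torus.scalarL2Sq h) * ∫ r in a..b, ρm (t - r) := by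
  intro κ W h ρm hκ hW hdiv hh hanti hnn hdecay a b T' θ' ψ ha hab hbT hθ' hθ'0 hψ hψb t ht
  -- the defect of the steady profile is bounded in `L²` on `[a, b]`
  set F : ℝ → UnitAddTorus (Fin 2) → ℝ := fun σ x =>
    ⟪W σ x, Torus.gradient h x⟫_ℝ - κ * Torus.laplacian h x with hF_def
  have hF : Torus.IsSmoothSpaceTimeOn (Icc a b) F :=
    ((hW.mono fun σ hσ => ha.trans hσ.1).inner (Torus.isSmoothSpaceTimeOn_const hh.gradient _)).sub
      (Torus.isSmoothSpaceTimeOn_const ((Torus.isSmooth_const κ).smul' hh.laplacian) _)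
  obtain ⟨C₀, hC₀⟩ := hF.exists_norm_le_of_isCompact isCompact_Icc subset_rfl
  have hC : ∀ σ ∈ Icc a b,
      √(∫ x, (⟪W σ x, Torus.gradient h x⟫_ℝ - κ * Torus.laplacian h x) ^ 2) ≤ |C₀| := by
    intro σ hσ
    have hFσ : Torus.IsSmooth (F σ) := hF.isSmooth_slice hσ
    rw [Real.sqrt_le_left (abs_nonneg _), sq_abs]
    calc ∫ x, (⟪W σ x, Torus.gradient h x⟫_ℝ - κ * Torus.laplacian h x) ^ 2
        ≤ ∫ _x : UnitAddTorus (Fin 2), C₀ ^ 2 := by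
          refine integral_mono (hFσ.continuous.pow 2).integrable_unitAddTorus (integrable_const _)
            fun x => ?_
          have hx := hC₀ σ hσ x
          rw [Real.norm_eq_abs] at hx
          exact sq_le_sq' (abs_le.1 hx).1 (abs_le.1 hx).2
      _ = C₀ ^ 2 := by simp
  -- the partition estimate for every `m`
  set H : ℝ := √(Torus.scalarL2Sq h) with hH_def
  set I : ℝ := ∫ r in a..b, ρm (t - r) with hI_def
  have hH : 0 ≤ H := Real.sqrt_nonneg _
  have hmono : Monotone fun r => ρm (t - r) := fun x y hxy => hanti (by linarith)
  have hm : ∀ m : ℕ, √(Torus.scalarL2Sq (ψ t)) ≤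
      H * (I + (b - a) / (m + 1) * ρm (t - b)) + (m + 1) * |C₀| * ((b - a) / (m + 1)) ^ 2 := by
    intro m
    have hpart := sqrt_scalarL2Sq_release_le_partition hκ hW hdiv hh hanti hnn hdecay ha hbT hC m a
      θ' ψ le_rfl hab hθ' hθ'0 hψ hψb t ht
    have hm1 : (0 : ℝ) < (m : ℝ) + 1 := by positivity
    have hδ0 : 0 ≤ (b - a) / (m + 1) := div_nonneg (sub_nonneg.2 hab.le) hm1.le
    have hδ1 : a + (b - a) / (m + 1) ≤ b := by
      rw [add_comm, ← le_sub_iff_add_le]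
      exact div_le_self (sub_nonneg.2 hab.le) (by linarith)
    have hIm : ∫ r in (a + (b - a) / (m + 1))..b, ρm (t - r) ≤ I :=
      intervalIntegral.integral_mono_interval (le_add_of_nonneg_right hδ0) hδ1 le_rfl
        (Eventually.of_forall fun r => hnn _) hmono.intervalIntegrable
    have hHIm := mul_le_mul_of_nonneg_left hIm hH
    linarith
  -- `m → ∞`
  refine le_of_forall_pos_le_add fun ε hε => ?_
  set K : ℝ := H * ρm (t - b) + |C₀| * (b - a) with hK_def
  have hK : 0 ≤ K :=
    add_nonneg (mul_nonneg (Real.sqrt_nonneg _) (hnn _)) (mul_nonneg (abs_nonneg _) (sub_nonneg.2 hab.le))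
  obtain ⟨m, hm'⟩ := exists_nat_gt ((b - a) * K / ε)
  have hm1 : (0 : ℝ) < (m : ℝ) + 1 := by positivity
  have hδK : (b - a) / (m + 1) * K ≤ ε := by
    rw [div_mul_eq_mul_div, div_le_iff₀ hm1]
    have h1 := (div_lt_iff₀ hε).1 hm'
    nlinarith
  have hkey : H * (I + (b - a) / (m + 1) * ρm (t - b)) + (m + 1) * |C₀| * ((b - a) / (m + 1)) ^ 2 =
      H * I + (b - a) / (m + 1) * K := by
    rw [hK_def]
    field_simp
    ring
  linarith [hm m]

end Summit.AnomalousDissipation.AnomalousDissipation.Theorems.ScalarAnomalySteadySourceFormal.DuhamelMajorant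

end
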